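import Literature.Probability.LatticeModels.RCWeights
import HarnessLib

/-!
# Random-cluster contours, VI: the cluster-count decomposition

Topic `Literature/Probability/LatticeModels`. The `q`-part of the decomposition of the weight of a
configuration according to its external contours (Grimmett 2006, §7.5, eqs. (7.18)–(7.22), (7.66);
the cluster analogue of FV (7.28)): for a configuration `ω` of the volume `V` (with `★`-connected
complement) with boundary condition `σ` and external contours `Γ'`,
`κ^σ_V(ω) = [σ = dis] |V^ext| + Σ_{γ ∈ Γ'} cwt(γ) + Σ_{γ} Σ_{A ∈ ints γ} κ^{lab A}_A(ω ∩ freeEdges A)`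
(`kappa_decomposition`), where `cwt(γ)` is the intrinsic cluster exponent of the contour (classes of
the glued graph on `γ̄ ∪ O_γ ∪ ⋃ ∂^in A_ord`, minus one for the exterior class if the type is `ord`).
The proof glues along the wired blocks with the formulas of `RCClassCount`: the exterior part `V^ext`
is one open cluster (wired boundary layer, `ord`) or totally disconnected (`dis`); hulls of distinct
external contours do not touch; inside a hull, `ord` interior components are glued along their
(`★`-connected, open) interior boundary and `dis` ones are separated.

Everything is proved; no named facts.

## References

* G. Grimmett, *The Random-Cluster Model*, Springer 2006, §7.5, eqs. (7.18)–(7.22) and (7.65)–(7.66).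
  [Grimmett2006]
* S. Friedli, Y. Velenik, *Statistical Mechanics of Lattice Systems*, CUP 2017, §7.3.1, eq. (7.28).
  [FriedliVelenik2017]
-/

noncomputable section

open Finset Relation

namespace Literature.Probability.LatticeModels

/-! ### More on class counts: congruence and wiring several blocks -/

namespace ClassCount

variable {α : Type*} [DecidableEq α] {R R' : α → α → Prop} {U : Finset α}

omit [DecidableEq α] in
/-- Chains only see the relation on `U`. [folklore] -/
theorem reflTransGen_congr (h : ∀ a ∈ U, ∀ b ∈ U, (R a b ↔ R' a b)) {x y : α} (hxy : ReflTransGen (relIn R U) x y) :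
    ReflTransGen (relIn R' U) x y :=
  reflTransGen_mono (fun a ha b hb hab => (h a ha b hb).1 hab) hxy

omit [DecidableEq α] in
/-- Classes only see the relation on `U`. [folklore] -/
theorem cls_congr (h : ∀ a ∈ U, ∀ b ∈ U, (R a b ↔ R' a b)) (x : α) : cls R U x = cls R' U x :=
  Subset.antisymm (cls_subset_cls (fun a ha b hb hab => (h a ha b hb).1 hab) x)
    (cls_subset_cls (fun a ha b hb hab => (h a ha b hb).2 hab) x)

/-- **The number of classes only depends on the relation on `U`.** [folklore] -/
theorem ccount_congr (h : ∀ a ∈ U, ∀ b ∈ U, (R a b ↔ R' a b)) : ccount R U = ccount R' U := by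
  classical
  rw [ccount, ccount, image_congr fun x _ => cls_congr h x]

/-- A non-empty set has at least one class. [folklore] -/
theorem ccount_pos (hU : U.Nonempty) : 0 < ccount R U := by
  classical
  obtain ⟨x, hx⟩ := hU
  exact card_pos.2 ⟨_, mem_image_of_mem _ hx⟩

/-- The relation `R` with every block of `ℬ` wired. [cite: Grimmett2006, §4.2] -/
def wireAll (R : α → α → Prop) (ℬ : Finset (Finset α)) (a b : α) : Prop := R a b ∨ ∃ L ∈ ℬ, a ∈ L ∧ b ∈ L

omit [DecidableEq α] in
/-- `wireAll` is symmetric when `R` is. [folklore] -/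
theorem wireAll_symm (hR : ∀ a b, R a b → R b a) (ℬ : Finset (Finset α)) : ∀ a b, wireAll R ℬ a b → wireAll R ℬ b a :=
  fun _ _ h => h.elim (fun h => Or.inl (hR _ _ h)) fun ⟨L, hL, ha, hb⟩ => Or.inr ⟨L, hL, hb, ha⟩

omit [DecidableEq α] in
/-- **Wiring blocks each lying inside one class does not change the classes.** [cite: Grimmett2006, §4.2] -/
theorem cls_wireAll_eq {ℬ : Finset (Finset α)} (hℬ : ∀ L ∈ ℬ, ∀ a ∈ L, ∀ b ∈ L, ReflTransGen (relIn R U) a b) (x : α) :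
    cls (wireAll R ℬ) U x = cls R U x := by
  refine Subset.antisymm (fun z hz => ?_) (cls_subset_cls (fun a _ b _ h => Or.inl h) x)
  obtain ⟨hzU, h⟩ := mem_cls.1 hz
  have key : ∀ w, ReflTransGen (relIn (wireAll R ℬ) U) x w → ReflTransGen (relIn R U) x w := by
    intro w hw
    induction hw with
    | refl => exact ReflTransGen.refl
    | tail _ hbc ih =>
      rcases hbc.1 with h | ⟨L, hL, ha, hb⟩
      · exact ih.tail ⟨h, hbc.2.1, hbc.2.2⟩
      · exact ih.trans (hℬ L hL _ ha _ hb)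
  exact mem_cls.2 ⟨hzU, key z h⟩

/-- **Wiring blocks each lying inside one class does not change the number of classes.** [cite: Grimmett2006, §4.2] -/
theorem ccount_wireAll_eq {ℬ : Finset (Finset α)} (hℬ : ∀ L ∈ ℬ, ∀ a ∈ L, ∀ b ∈ L, ReflTransGen (relIn R U) a b) :
    ccount (wireAll R ℬ) U = ccount R U := by
  classical
  rw [ccount, ccount, image_congr fun x _ => cls_wireAll_eq hℬ x]

end ClassCount

namespace RCC

open ContourSetup ClassCount

variable {d : ℕ}

/-! ### Converting `★`-chains of `ord`-good sites into open lattice chains -/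

/-- An `ord`-good site whose ball lies in `U` is joined inside `U` by open edges to every site of its
ball. [cite: FriedliVelenik2017, §7.2.1] -/
theorem reflTransGen_rOpen_of_ordGood {σ : Phase} {F ω : Finset (Sym2 (Site d))} {U : Finset (Site d)} {x : Site d}
    (hx : OrdGood σ F ω x) (hU : starBall x ⊆ U) {y : Site d} (hy : y ∈ starBall x) :
    ReflTransGen (relIn (ROpen σ F ω) U) x y := by
  have key : ∀ w, ReflTransGen (fun a b => ((zdGraph d).Adj a b ∧ EOpen σ F ω s(a, b)) ∧ a ∈ (U : Set (Site d)) ∧ b ∈ (U : Set (Site d))) x w →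
      ReflTransGen (relIn (ROpen σ F ω) U) x w := by
    intro w hw
    induction hw with
    | refl => exact ReflTransGen.refl
    | tail _ hbc ih => exact ih.tail ⟨hbc.1, mem_coe.1 hbc.2.1, mem_coe.1 hbc.2.2⟩
  exact key y (reflTransGen_open_of_ordGood hx (U := (U : Set (Site d))) (fun z hz => mem_coe.2 (hU (mem_coe.1 hz))) hy)

/-- A `★`-chain through `ord`-good sites whose balls lie in `U` yields an open lattice chain inside `U`.
[cite: FriedliVelenik2017, §7.2.1] -/
theorem reflTransGen_rOpen_of_starChain {σ : Phase} {F ω : Finset (Sym2 (Site d))} {U : Finset (Site d)} {G : Set (Site d)}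
    (hG : ∀ z ∈ G, OrdGood σ F ω z ∧ starBall z ⊆ U) {x y : Site d} (h : ReflTransGen (starRel G) x y) :
    ReflTransGen (relIn (ROpen σ F ω) U) x y := by
  induction h with
  | refl => exact ReflTransGen.refl
  | tail _ hbc ih =>
    obtain ⟨hg, hU⟩ := hG _ hbc.2.1
    exact ih.trans (reflTransGen_rOpen_of_ordGood hg hU ((adj_iff_mem_starBall.1 hbc.1).1))

/-! ### The setting -/

section Setting

variable {σ : Phase} {V : Finset (Site d)} {ω : Finset (Sym2 (Site d))} (hd : 2 ≤ d) (hω : ω ⊆ freeEdges V)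
  (hV : StarConn (V : Set (Site d))ᶜ)

/-- The exterior block of a contour: `O_γ = ∂^ex(hull γ̄)`. [cite: Grimmett2006, §7.5] -/
def Oblock (γ : (rcSetup d).Γ) : Finset (Site d) := exBoundary ((rcSetup d).hull γ)

include hd in
/-- `O_γ ⊆ V^ext`. [cite: FriedliVelenik2017, §7.3, proof of Lemma 7.23] -/
theorem oblock_subset_Vext {γ : (rcSetup d).Γ} (hγ : γ ∈ extContours σ hω) : Oblock γ ⊆ Vext σ V hω := by
  intro y hy
  obtain ⟨hyb, -⟩ := mem_exBoundary_of_mem_exBoundary_hull hd hy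
  refine (mem_Vext_iff hd hω).2 ⟨?_, exBoundary_hull_subset_exteriorAll hd hγ (mem_coe.2 hy)⟩
  obtain ⟨-, x, hx, hxy⟩ := mem_exBoundary.1 hyb
  exact inVol_of_mem_extContours hγ (mem_biUnion.2 ⟨x, hx, (adj_iff_mem_starBall.1 hxy).1⟩)

include hd in
/-- `O_γ` is non-empty. [folklore] -/
theorem oblock_nonempty (γ : (rcSetup d).Γ) : (Oblock γ).Nonempty := by
  obtain ⟨x, hx⟩ := (rcSetup d).supp_nonempty γ
  exact exBoundary_nonempty (by omega) ⟨x, supp_subset_hull hd (S := rcSetup d) γ hx⟩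

/-- Lattice steps out of a hull land in its exterior block. [folklore] -/
theorem mem_oblock_of_adj {γ : (rcSetup d).Γ} {a b : Site d} (ha : a ∈ (rcSetup d).hull γ) (hb : b ∉ (rcSetup d).hull γ)
    (hab : (zdGraph d).Adj a b) : b ∈ Oblock γ :=
  mem_exBoundary.2 ⟨hb, a, ha, zdGraph_le_zdStar hab⟩

/-- `O_γ` misses the hull. [folklore] -/
theorem disjoint_oblock_hull (γ : (rcSetup d).Γ) : Disjoint (Oblock γ) ((rcSetup d).hull γ) :=
  Finset.disjoint_left.2 fun _ hy => (mem_exBoundary.1 hy).1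

/-- Hulls of external contours miss `V^ext`. [folklore] -/
theorem disjoint_hull_Vext {γ : (rcSetup d).Γ} (hγ : γ ∈ extContours σ hω) : Disjoint ((rcSetup d).hull γ) (Vext σ V hω) :=
  Finset.disjoint_left.2 fun _ hx hxV => (mem_filter.1 hxV).2 γ hγ hx

include hd hω in
/-- Sites of `V^ext` are good of type `σ`. [cite: FriedliVelenik2017, §7.3, Lemma 7.23] -/
theorem good_of_mem_Vext {x : Site d} (hx : x ∈ Vext σ V hω) : Good σ (freeEdges V) ω σ x :=
  good_of_mem_exteriorAll hd hω ((mem_Vext_iff hd hω).1 hx).2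

include hd in
/-- The boundary layer `V ∖ inner1 V` lies in `V^ext`. [cite: FriedliVelenik2017, §7.3] -/
theorem sdiff_inner1_subset_Vext (hV : StarConn (V : Set (Site d))ᶜ) : V \ inner1 V ⊆ Vext σ V hω := by
  intro x hx
  obtain ⟨hxV, hxi⟩ := mem_sdiff.1 hx
  refine mem_filter.2 ⟨hxV, fun γ hγ hxγ => hxi ((hull_subset_inner1 hd hV hγ).1 hxγ)⟩

/-! ### (K1) For `ord` boundary condition the exterior part is one wired-open cluster -/

include hd hω in
/-- **Every site of `V^ext` is joined by open edges inside `V` to the boundary layer** (`σ = ord`).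
[cite: Grimmett2006, §7.5 (the exterior cluster); FriedliVelenik2017, §7.3, Lemma 7.23] -/
theorem exists_chain_to_layer_of_mem_Vext {a : Site d} (ha : a ∈ Vext Phase.ord V hω) :
    ∃ b ∈ V \ inner1 V, ReflTransGen (relIn (ROpen Phase.ord (freeEdges V) ω) V) a b := by
  have hd1 : 1 ≤ d := by omega
  obtain ⟨haV, haE⟩ := (mem_Vext_iff hd hω).1 ha
  by_cases hai : a ∈ inner1 V
  swap
  · exact ⟨a, mem_sdiff.2 ⟨haV, hai⟩, ReflTransGen.refl⟩
  -- a far point outside `V`, in the exterior of all contours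
  set R := max (boxRadius V) (boxRadius (thick Phase.ord (freeEdges V) ω)) with hR
  set z₀ : Site d := fun _ => (R : ℤ) + 1
  have hz₀ : z₀ ∉ box d R := mem_farSet_iff_not_mem_box.1 (corner_mem_farSet hd1 le_rfl)
  have hz₀V : z₀ ∉ V := fun h => hz₀ ((subset_box_boxRadius V).trans (box_mono d (le_max_left _ _)) h)
  have hz₀E : z₀ ∈ exteriorAll Phase.ord (freeEdges V) ω :=
    mem_exteriorAll_of_not_mem_box hd ((subset_box_boxRadius _).trans (box_mono d (le_max_right _ _))) hz₀
  have hchain := starConn_exteriorAll hd a haE z₀ hz₀E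
  -- first exit from `inner1 V`
  set P : Set (Site d) := ↑(inner1 V) with hP
  have hno : ¬ ReflTransGen (starRel (exteriorAll Phase.ord (freeEdges V) ω ∩ P)) a z₀ := fun h =>
    hz₀V (inner1_subset V (mem_coe.1 (mem_of_reflTransGen_starRel h ⟨haE, mem_coe.2 hai⟩).2))
  obtain ⟨p, v, hp, hv, hpv, hap, -⟩ := exists_first_exit hchain (mem_coe.2 hai) hno
  have hpV : starBall p ⊆ V := mem_inner1.1 (mem_coe.1 hp)
  have hvV : v ∈ V := hpV ((adj_iff_mem_starBall.1 hpv.1).1)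
  refine ⟨v, mem_sdiff.2 ⟨hvV, fun h => hv (mem_coe.2 h)⟩, ?_⟩
  -- convert the `★`-chain into an open chain
  have hG : ∀ z ∈ exteriorAll Phase.ord (freeEdges V) ω ∩ P, OrdGood Phase.ord (freeEdges V) ω z ∧ starBall z ⊆ V :=
    fun z hz => ⟨good_of_mem_exteriorAll hd hω hz.1, mem_inner1.1 (mem_coe.1 hz.2)⟩
  have h1 := reflTransGen_rOpen_of_starChain hG hap
  have h2 : ReflTransGen (relIn (ROpen Phase.ord (freeEdges V) ω) V) p v :=
    reflTransGen_rOpen_of_ordGood (good_of_mem_exteriorAll hd hω hpv.2.1) hpV ((adj_iff_mem_starBall.1 hpv.1).1)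
  exact h1.trans h2

include hd hω in
/-- **(K1)** For `σ = ord`, all of `V^ext` lies in one class of the boundary-wired open relation on `V`.
[cite: Grimmett2006, §7.5] -/
theorem vext_one_class_ord (hσ : σ = Phase.ord) {a b : Site d} (ha : a ∈ Vext σ V hω) (hb : b ∈ Vext σ V hω) :
    ReflTransGen (relIn (wire (ROpen σ (freeEdges V) ω) (V \ inner1 V)) V) a b := by
  subst hσ
  obtain ⟨a', ha', haa'⟩ := exists_chain_to_layer_of_mem_Vext hd hω ha
  obtain ⟨b', hb', hbb'⟩ := exists_chain_to_layer_of_mem_Vext hd hω hb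
  have hmono : ∀ {x y}, ReflTransGen (relIn (ROpen Phase.ord (freeEdges V) ω) V) x y →
      ReflTransGen (relIn (wire (ROpen Phase.ord (freeEdges V) ω) (V \ inner1 V)) V) x y :=
    fun h => reflTransGen_mono (fun a _ b _ hab => Or.inl hab) h
  have hstep : ReflTransGen (relIn (wire (ROpen Phase.ord (freeEdges V) ω) (V \ inner1 V)) V) a' b' :=
    ReflTransGen.single ⟨Or.inr ⟨ha', hb'⟩, (mem_sdiff.1 ha').1, (mem_sdiff.1 hb').1⟩
  exact ((hmono haa').trans hstep).trans (reflTransGen_symm (wire_symm (rOpen_symm _ _ _) _) (hmono hbb'))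

/-! ### Interior components: boundary classes and separation -/

variable {γ : (rcSetup d).Γ} (hγ : γ ∈ extContours σ hω)

include hd in
/-- The ball of a site of an interior component lies in the hull. [folklore] -/
theorem starBall_subset_hull_of_mem_ints {A : Finset (Site d)} (hA : A ∈ (rcSetup d).ints γ) {u : Site d} (hu : u ∈ A) :
    starBall u ⊆ (rcSetup d).hull γ := by
  intro z hz
  by_cases hzS : z ∈ (rcSetup d).supp γ
  · exact supp_subset_hull hd (S := rcSetup d) γ hzS
  · by_cases hzu : u = z
    · exact hzu ▸ (intr_subset_hull (S := rcSetup d) γ (subset_intr_of_mem_ints (S := rcSetup d) hA hu))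
    · exact intr_subset_hull (S := rcSetup d) γ (subset_intr_of_mem_ints (S := rcSetup d) hA
        (mem_of_adj_of_mem_ints hd (S := rcSetup d) hA hu hzS (adj_iff_mem_starBall.2 ⟨hz, hzu⟩)))

include hd hω hγ in
/-- **(K3)** The interior boundary of an `ord`-labelled interior component lies in one open class inside
the hull. [cite: Grimmett2006, §7.5; FriedliVelenik2017, Lemma 7.19] -/
theorem inBoundary_one_class {A : Finset (Site d)} (hA : A ∈ (rcSetup d).ints γ) (hlab : (rcSetup d).lab γ A = Phase.ord)
    {a b : Site d} (ha : a ∈ inBoundary A) (hb : b ∈ inBoundary A) :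
    ReflTransGen (relIn (ROpen σ (freeEdges V) ω) ((rcSetup d).hull γ)) a b := by
  obtain ⟨u, hu, rfl⟩ := mem_ints.1 hA
  have hconn := (starConn_boundaries_starIntComp hd ((rcSetup d).supp_starConn γ) hu).1 a (mem_coe.2 ha) b (mem_coe.2 hb)
  refine reflTransGen_rOpen_of_starChain (fun z hz => ⟨?_, starBall_subset_hull_of_mem_ints hd hA (mem_inBoundary.1 (mem_coe.1 hz)).1⟩) hconn
  exact (lab_eq_ord_iff_of_mem_inBoundary hd hω hγ hA (mem_coe.1 hz)).1 hlab

include hd hω hγ in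
/-- **(K4)** No open edge leaves a `dis`-labelled interior component. [cite: Grimmett2006, §7.5] -/
theorem not_rOpen_of_lab_dis {A : Finset (Site d)} (hA : A ∈ (rcSetup d).ints γ) (hlab : (rcSetup d).lab γ A = Phase.dis)
    {a b : Site d} (ha : a ∈ A) (hb : b ∉ A) : ¬ ROpen σ (freeEdges V) ω a b := by
  rintro ⟨hab, ho⟩
  obtain ⟨hab', -⟩ := mem_inBoundary_of_adj hd hA ha hb (zdStar_adj.1 (zdGraph_le_zdStar hab)).2
  have hnb := not_bad_of_mem_starBall_inBoundary hd hω hγ hA hab' (mem_starBall_self a)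
  have hno : ¬ OrdGood σ (freeEdges V) ω a := fun h => by
    have := (lab_eq_ord_iff_of_mem_inBoundary hd hω hγ hA hab').2 h
    rw [hlab] at this; exact absurd this (by decide)
  exact ((eOpen_iff_ordGood_of_not_bad hnb (mk_mem_ballEdges_of_mem_nbrs (mem_nbrs.2 hab))).1 ho |> hno)

include hd hω hV hγ in
/-- **(K5a)** On an interior component the open relation is that of the restricted configuration.
[cite: FriedliVelenik2017, §7.3.1] -/
theorem rOpen_iff_of_mem_ints {A : Finset (Site d)} (hA : A ∈ (rcSetup d).ints γ) {a b : Site d} (ha : a ∈ A) :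
    ROpen σ (freeEdges V) ω a b ↔ ROpen ((rcSetup d).lab γ A) (freeEdges A) (ω ∩ freeEdges A) a b := by
  constructor
  · rintro ⟨hab, ho⟩; exact ⟨hab, (eOpen_iff_eOpen_inter hd hω hV hγ hA ha (mem_nbrs.2 hab)).1 ho⟩
  · rintro ⟨hab, ho⟩; exact ⟨hab, (eOpen_iff_eOpen_inter hd hω hV hγ hA ha (mem_nbrs.2 hab)).2 ho⟩

include hd in
/-- Sites of the glued set `Ugl` are in the support or in its exterior boundary. [folklore] -/
theorem mem_supp_or_exBoundary_of_mem_Ugl {a : Site d} (ha : a ∈ γ.1.Ugl) : a ∈ γ.1.supp ∨ a ∈ exBoundary γ.1.supp := by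
  rw [Contour.Ugl, mem_union, mem_union] at ha
  rcases ha with (h | h) | h
  · exact Or.inl h
  · rw [Contour.Opart] at h
    split_ifs at h with ht
    · exact Or.inr (mem_exBoundary_of_mem_exBoundary_hull hd h).1
    · exact absurd h (notMem_empty a)
  · obtain ⟨A, hA, haA⟩ := mem_biUnion.1 h
    obtain ⟨hA, -⟩ := mem_filter.1 hA
    have hA' : A ∈ (rcSetup d).ints γ := hA
    refine Or.inr ?_
    obtain ⟨haA', w, hwA, haw⟩ := mem_inBoundary.1 haA
    have hwS : w ∈ γ.1.supp := by
      by_contra hwS; exact hwA (mem_of_adj_of_mem_ints hd (S := rcSetup d) hA' haA' hwS haw)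
    exact mem_exBoundary.2 ⟨Finset.disjoint_left.1 (disjoint_supp_of_mem_ints hd (S := rcSetup d) hA') haA', w, hwS, haw.symm⟩

include hd hω hγ in
/-- **(K5b)** On the glued set the open relation is the intrinsic one. [cite: FriedliVelenik2017, §7.2.6] -/
theorem rOpen_iff_of_mem_Ugl {a b : Site d} (ha : a ∈ γ.1.Ugl) : ROpen σ (freeEdges V) ω a b ↔ γ.1.ROpen a b := by
  obtain ⟨hs, -⟩ := supp_mem_of_mem_extContours hγ
  obtain ⟨T, -, hγT⟩ := mem_extContours.1 hγ
  have hTs : T.1 = γ.1.supp := by rw [hγT]; rfl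
  have hγT' := hγT
  rw [hTs] at hγT'
  have key : ∀ {e}, e ∈ ballEdges a → (γ.1.IsOpen e ↔ EOpen σ (freeEdges V) ω e) := by
    intro e he
    rcases mem_supp_or_exBoundary_of_mem_Ugl hd ha with h | h
    · rw [hγT']; exact isOpen_iff_eOpen_of_mem_supp hω hs hd h he
    · rw [hγT']; exact isOpen_iff_eOpen_of_mem_exBoundary hω hs hd h he
  constructor
  · rintro ⟨hab, ho⟩; exact ⟨hab, (key (mk_mem_ballEdges_of_mem_nbrs (mem_nbrs.2 hab))).2 ho⟩
  · rintro ⟨hab, ho⟩; exact ⟨hab, (key (mk_mem_ballEdges_of_mem_nbrs (mem_nbrs.2 hab))).1 ho⟩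

/-! ### The per-contour gluing -/

/-- The wired relation used inside a hull: open adjacency, the exterior block wired (if `σ = ord`),
every `ord` interior boundary wired. [cite: Grimmett2006, §7.5] -/
def Rhull (σ : Phase) (V : Finset (Site d)) (ω : Finset (Sym2 (Site d))) (γ : (rcSetup d).Γ) : Site d → Site d → Prop :=
  wireAll (ROpen σ (freeEdges V) ω) (insert γ.1.Opart (γ.1.ordInts.image inBoundary))

/-- `Rhull` is symmetric. [folklore] -/
theorem rhull_symm (γ : (rcSetup d).Γ) : ∀ a b, Rhull σ V ω γ a b → Rhull σ V ω γ b a :=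
  wireAll_symm (rOpen_symm _ _ _) _

include hd hω hγ in
/-- On the glued set, `Rhull` is the intrinsic wired relation `Rsharp`. [folklore] -/
theorem rhull_iff_rsharp {a b : Site d} (ha : a ∈ γ.1.Ugl) (_hb : b ∈ γ.1.Ugl) : Rhull σ V ω γ a b ↔ γ.1.Rsharp a b := by
  rw [Rhull, wireAll, Contour.Rsharp, rOpen_iff_of_mem_Ugl hd hω hγ ha]
  refine or_congr_right ⟨?_, ?_⟩
  · rintro ⟨L, hL, haL, hbL⟩
    rcases mem_insert.1 hL with rfl | hL
    · exact Or.inl ⟨haL, hbL⟩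
    · obtain ⟨A, hA, rfl⟩ := mem_image.1 hL
      exact Or.inr ⟨A, hA, haL, hbL⟩
  · rintro (⟨haO, hbO⟩ | ⟨A, hA, haA, hbA⟩)
    · exact ⟨_, mem_insert_self _ _, haO, hbO⟩
    · exact ⟨_, mem_insert_of_mem (mem_image_of_mem _ hA), haA, hbA⟩

/-- `ordInts` are interior components. [folklore] -/
theorem mem_ints_of_mem_ordInts {A : Finset (Site d)} (hA : A ∈ γ.1.ordInts) : A ∈ (rcSetup d).ints γ ∧ (rcSetup d).lab γ A = Phase.ord :=
  ⟨(mem_filter.1 hA).1, (mem_filter.1 hA).2⟩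

/-- The exterior block of an external contour of type `σ`. [folklore] -/
theorem opart_eq (hσ : (rcSetup d).type γ = σ) : γ.1.Opart = if σ = Phase.ord then Oblock γ else ∅ := by
  have : γ.1.type = σ := hσ
  rw [Contour.Opart, this]; rfl

/-- The exterior block misses the hull. [folklore] -/
theorem disjoint_opart_hull : Disjoint γ.1.Opart ((rcSetup d).hull γ) := by
  rw [Contour.Opart]
  split_ifs
  · exact disjoint_oblock_hull γ
  · exact disjoint_empty_left _

include hd in
/-- An interior component meets the glued set exactly in its interior boundary (if `ord`) or not at all
(if `dis`). [folklore] -/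
theorem inter_Ugl_of_mem_ints {A : Finset (Site d)} (hA : A ∈ (rcSetup d).ints γ) :
    A ∩ γ.1.Ugl = if (rcSetup d).lab γ A = Phase.ord then inBoundary A else ∅ := by
  ext x
  rw [mem_inter, Contour.Ugl, mem_union, mem_union, mem_biUnion]
  have hxS : x ∈ A → x ∉ γ.1.supp := fun hx => Finset.disjoint_left.1 (disjoint_supp_of_mem_ints hd (S := rcSetup d) hA) hx
  have hxO : x ∈ A → x ∉ γ.1.Opart := fun hx hxO => Finset.disjoint_left.1 (disjoint_opart_hull (γ := γ)) hxO
    (intr_subset_hull (S := rcSetup d) γ (subset_intr_of_mem_ints (S := rcSetup d) hA hx))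
  have hcomp : ∀ A' ∈ γ.1.ordInts, x ∈ A → x ∈ inBoundary A' → A' = A := fun A' hA' hx hx' => by
    by_contra hne
    exact Finset.disjoint_left.1 (disjoint_of_mem_ints hd (S := rcSetup d) (mem_ints_of_mem_ordInts hA').1 hA hne)
      (mem_inBoundary.1 hx').1 hx
  split_ifs with hlab
  · constructor
    · rintro ⟨hx, (h | h) | ⟨A', hA', hx'⟩⟩
      · exact absurd h (hxS hx)
      · exact absurd h (hxO hx)
      · exact hcomp A' hA' hx hx' ▸ hx'
    · intro hx
      exact ⟨(mem_inBoundary.1 hx).1, Or.inr ⟨A, mem_filter.2 ⟨hA, hlab⟩, hx⟩⟩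
  · constructor
    · rintro ⟨hx, (h | h) | ⟨A', hA', hx'⟩⟩
      · exact absurd h (hxS hx)
      · exact absurd h (hxO hx)
      · have := hcomp A' hA' hx hx'
        subst this
        exact absurd (mem_ints_of_mem_ordInts hA').2 hlab
    · intro h; exact absurd h (notMem_empty x)

include hd in
/-- The interior boundary of an interior component is non-empty. [folklore] -/
theorem inBoundary_nonempty_of_mem_ints {A : Finset (Site d)} (hA : A ∈ (rcSetup d).ints γ) : (inBoundary A).Nonempty := by
  obtain ⟨y, hy⟩ := exBoundary_nonempty (by omega) (nonempty_of_mem_ints hd (S := rcSetup d) hA)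
  obtain ⟨hyA, x, hx, hxy⟩ := mem_exBoundary.1 hy
  exact ⟨x, mem_inBoundary.2 ⟨hx, y, hyA, hxy⟩⟩

/-- A site of an interior component off its interior boundary has its ball inside the component. [folklore] -/
theorem starBall_subset_of_not_mem_inBoundary {A : Finset (Site d)} {b : Site d} (hb : b ∈ A) (hb' : b ∉ inBoundary A) :
    starBall b ⊆ A := by
  intro z hz
  by_contra hzA
  exact hb' (mem_inBoundary.2 ⟨hb, z, hzA, adj_iff_mem_starBall.2 ⟨hz, fun h => hzA (h ▸ hb)⟩⟩)

include hd hω hV hγ in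
/-- **Gluing one interior component.** For `𝒜 ⊆ ints γ` not containing `A ∈ ints γ`, with
`U = Ugl ∪ ⋃ 𝒜`: `ccount Rhull (U ∪ A) = ccount Rhull U + κ^{lab A}_A(ω ∩ freeEdges A)`.
[cite: Grimmett2006, §7.5, eqs. (7.18)–(7.21)] -/
theorem ccount_glue_int {𝒜 : Finset (Finset (Site d))} (h𝒜 : 𝒜 ⊆ (rcSetup d).ints γ) {A : Finset (Site d)}
    (hA : A ∈ (rcSetup d).ints γ) (hA𝒜 : A ∉ 𝒜) :
    ccount (Rhull σ V ω γ) (γ.1.Ugl ∪ 𝒜.biUnion id ∪ A) =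
      ccount (Rhull σ V ω γ) (γ.1.Ugl ∪ 𝒜.biUnion id) + kappa ((rcSetup d).lab γ A) A (freeEdges A) (ω ∩ freeEdges A) := by
  set U := γ.1.Ugl ∪ 𝒜.biUnion id with hU
  set R := Rhull σ V ω γ with hR
  have hRs : ∀ a b, R a b → R b a := rhull_symm γ
  have hUgl : γ.1.Ugl ⊆ U := subset_union_left
  -- `A` meets `U` only inside `Ugl`
  have hAU : U ∩ A = A ∩ γ.1.Ugl := by
    ext x
    simp only [hU, mem_inter, mem_union, mem_biUnion, id_eq]
    constructor
    · rintro ⟨h | ⟨A', hA', hx'⟩, hx⟩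
      · exact ⟨hx, h⟩
      · exfalso
        have hne : A' ≠ A := fun h => hA𝒜 (h ▸ hA')
        exact Finset.disjoint_left.1 (disjoint_of_mem_ints hd (S := rcSetup d) (h𝒜 hA') hA hne) hx' hx
    · rintro ⟨hx, h⟩; exact ⟨Or.inl h, hx⟩
  -- wiring blocks only contain points of `A` on `∂^in A`, and only if `lab A = ord`
  have hblock : ∀ L ∈ insert γ.1.Opart (γ.1.ordInts.image inBoundary), ∀ b ∈ L, b ∈ A →
      b ∈ inBoundary A ∧ (rcSetup d).lab γ A = Phase.ord := by
    intro L hL b hbL hbA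
    rcases mem_insert.1 hL with rfl | hL
    · exact absurd (intr_subset_hull (S := rcSetup d) γ (subset_intr_of_mem_ints (S := rcSetup d) hA hbA))
        (Finset.disjoint_left.1 (disjoint_opart_hull (γ := γ)) hbL)
    · obtain ⟨A', hA', rfl⟩ := mem_image.1 hL
      have : A' = A := by
        by_contra hne
        exact Finset.disjoint_left.1 (disjoint_of_mem_ints hd (S := rcSetup d) (mem_ints_of_mem_ordInts hA').1 hA hne)
          (mem_inBoundary.1 hbL).1 hbA
      subst this
      exact ⟨hbL, (mem_ints_of_mem_ordInts hA').2⟩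
  -- open steps out of `A` from points off `∂^in A` are impossible
  have hstepA : ∀ a b, b ∈ A → b ∉ inBoundary A → (zdGraph d).Adj a b → a ∈ A := fun a b hb hb' hab =>
    starBall_subset_of_not_mem_inBoundary hb hb' ((adj_iff_mem_starBall.1 (zdGraph_le_zdStar hab.symm)).1)
  have hApos : 0 < ccount R A := ccount_pos (nonempty_of_mem_ints hd (S := rcSetup d) hA)
  cases hl : (rcSetup d).lab γ A with
  | ord =>
    -- relation on `A`-pairs
    have hRA : ∀ a ∈ A, ∀ b ∈ A,
        (R a b ↔ wire (ROpen Phase.ord (freeEdges A) (ω ∩ freeEdges A)) (A \ inner1 A) a b) := by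
      intro a ha b hb
      rw [hR, Rhull, wireAll, wire, rOpen_iff_of_mem_ints hd hω hV hγ hA ha, hl, ← inBoundary_eq_sdiff_inner1]
      refine or_congr_right ⟨fun ⟨L, hL, haL, hbL⟩ => ⟨(hblock L hL a haL ha).1, (hblock L hL b hbL hb).1⟩, fun ⟨ha', hb'⟩ => ?_⟩
      exact ⟨inBoundary A, mem_insert_of_mem (mem_image_of_mem _ (mem_filter.2 ⟨hA, hl⟩)), ha', hb'⟩
    have hkappa : kappa Phase.ord A (freeEdges A) (ω ∩ freeEdges A) + 1 = ccount R A := by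
      change ccount _ A - 1 + 1 = _
      rw [← ccount_congr hRA]
      omega
    -- gluing along `∂^in A`
    have hL : U ∩ A = inBoundary A := by rw [hAU, inter_Ugl_of_mem_ints hd hA, hl, if_pos rfl]
    have hglue := ccount_union_add_one hRs hL (inBoundary_nonempty_of_mem_ints hd hA)
      (fun a haU haL b hbA hbL => ?_) (fun a ha b hb => ?_) (fun a ha b hb => ?_)
    · omega
    · constructor
      · rintro (hab | ⟨L, hL', haL', hbL'⟩)
        · exact haL (by rw [← hL]; exact mem_inter.2 ⟨haU, hstepA a b hbA hbL hab.1⟩)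
        · exact hbL (hblock L hL' b hbL' hbA).1
      · rintro (hba | ⟨L, hL', hbL', haL'⟩)
        · exact haL (by rw [← hL]; exact mem_inter.2 ⟨haU, hstepA a b hbA hbL hba.1.symm⟩)
        · exact hbL (hblock L hL' b hbL' hbA).1
    · have hblk : inBoundary A ∈ insert γ.1.Opart (γ.1.ordInts.image inBoundary) :=
        mem_insert_of_mem (mem_image_of_mem _ (mem_filter.2 ⟨hA, hl⟩))
      have haU : a ∈ U := by have := hL.symm ▸ ha; exact (mem_inter.1 this).1
      have hbU : b ∈ U := by have := hL.symm ▸ hb; exact (mem_inter.1 this).1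
      exact ReflTransGen.single ⟨Or.inr ⟨_, hblk, ha, hb⟩, haU, hbU⟩
    · have hblk : inBoundary A ∈ insert γ.1.Opart (γ.1.ordInts.image inBoundary) :=
        mem_insert_of_mem (mem_image_of_mem _ (mem_filter.2 ⟨hA, hl⟩))
      exact ReflTransGen.single ⟨Or.inr ⟨_, hblk, ha, hb⟩, (mem_inBoundary.1 ha).1, (mem_inBoundary.1 hb).1⟩
  | dis =>
    have hRA : ∀ a ∈ A, ∀ b ∈ A, (R a b ↔ ROpen Phase.dis (freeEdges A) (ω ∩ freeEdges A) a b) := by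
      intro a ha b hb
      rw [hR, Rhull, wireAll, rOpen_iff_of_mem_ints hd hω hV hγ hA ha, hl, or_iff_left]
      rintro ⟨L, hL, haL, -⟩
      have := (hblock L hL a haL ha).2
      rw [hl] at this; exact absurd this (by decide)
    have hkappa : kappa Phase.dis A (freeEdges A) (ω ∩ freeEdges A) = ccount R A := by
      change ccount _ A = _
      rw [← ccount_congr hRA]
    have hdisj : Disjoint U A := by
      rw [← disjoint_coe, Set.disjoint_iff_inter_eq_empty, ← coe_inter, hAU, inter_Ugl_of_mem_ints hd hA, hl]
      simp
    have hsep : ∀ a ∈ U, ∀ b ∈ A, ¬ R a b ∧ ¬ R b a := by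
      intro a ha b hb
      have haA : a ∉ A := Finset.disjoint_left.1 hdisj ha
      constructor
      · rintro (hab | ⟨L, hL', -, hbL'⟩)
        · exact not_rOpen_of_lab_dis hd hω hγ hA hl hb haA (rOpen_symm _ _ _ _ _ hab)
        · have := (hblock L hL' b hbL' hb).2; rw [hl] at this; exact absurd this (by decide)
      · rintro (hba | ⟨L, hL', hbL', -⟩)
        · exact not_rOpen_of_lab_dis hd hω hγ hA hl hb haA hba
        · have := (hblock L hL' b hbL' hb).2; rw [hl] at this; exact absurd this (by decide)
    rw [ccount_union_of_separated hsep hdisj, hkappa]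

include hd in
/-- `Ugl ∪ ⋃ ints = hull ∪ Opart`. [folklore] -/
theorem ugl_union_biUnion_ints : γ.1.Ugl ∪ ((rcSetup d).ints γ).biUnion id = (rcSetup d).hull γ ∪ γ.1.Opart := by
  ext x
  rw [Contour.Ugl, hull_eq_supp_union_biUnion_ints hd γ]
  simp only [mem_union, mem_biUnion, id_eq]
  constructor
  · rintro (((h | h) | ⟨A, hA, hx⟩) | ⟨A, hA, hx⟩)
    · exact Or.inl (Or.inl h)
    · exact Or.inr h
    · exact Or.inl (Or.inr ⟨A, (mem_ints_of_mem_ordInts hA).1, (mem_inBoundary.1 hx).1⟩)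
    · exact Or.inl (Or.inr ⟨A, hA, hx⟩)
  · rintro ((h | ⟨A, hA, hx⟩) | h)
    · exact Or.inl (Or.inl (Or.inl h))
    · exact Or.inr ⟨A, hA, hx⟩
    · exact Or.inl (Or.inl (Or.inr h))

include hd hω hV hγ in
/-- **The per-contour gluing** (Grimmett's contraction of the exterior and the interiors): the classes of
the wired open relation on `hull γ ∪ Opart γ` are the intrinsic classes of the glued contour graph plus the
cluster functionals of the interior components.
[cite: Grimmett2006, §7.5, eqs. (7.18)–(7.22), (7.66)] -/
theorem ccount_hull_union_opart :
    ccount (Rhull σ V ω γ) ((rcSetup d).hull γ ∪ γ.1.Opart) =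
      γ.1.ccl + ∑ A ∈ (rcSetup d).ints γ, kappa ((rcSetup d).lab γ A) A (freeEdges A) (ω ∩ freeEdges A) := by
  classical
  have key : ∀ 𝒜 : Finset (Finset (Site d)), 𝒜 ⊆ (rcSetup d).ints γ →
      ccount (Rhull σ V ω γ) (γ.1.Ugl ∪ 𝒜.biUnion id) =
        ccount (Rhull σ V ω γ) γ.1.Ugl + ∑ A ∈ 𝒜, kappa ((rcSetup d).lab γ A) A (freeEdges A) (ω ∩ freeEdges A) := by
    intro 𝒜
    induction 𝒜 using Finset.induction_on with
    | empty => intro; simp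
    | insert A 𝒜 hA𝒜 ih =>
      intro hsub
      rw [sum_insert hA𝒜, biUnion_insert, id_eq, union_comm A, ← union_assoc,
        ccount_glue_int hd hω hV hγ ((subset_insert _ _).trans hsub) (hsub (mem_insert_self _ _)) hA𝒜,
        ih ((subset_insert _ _).trans hsub)]
      ring
  rw [← ugl_union_biUnion_ints hd (γ := γ), key _ Subset.rfl, Contour.ccl,
    ccount_congr fun a ha b hb => rhull_iff_rsharp hd hω hγ ha hb]

/-- `ccl γ ≥ 1`. [folklore] -/
theorem ccl_pos (γ : (rcSetup d).Γ) : 0 < γ.1.ccl :=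
  ccount_pos ⟨_, mem_union_left _ (mem_union_left _ ((rcSetup d).supp_nonempty γ).choose_spec)⟩

/-! ### Relating `Rhull` to the global relations -/

include hd hω hγ in
/-- For `σ = ord`: on `hull ∪ O_γ`, the classes of `Rhull` are those of the `V^ext`-wired open relation.
[cite: Grimmett2006, §7.5] -/
theorem ccount_rhull_eq_ord (hσ : σ = Phase.ord) :
    ccount (Rhull σ V ω γ) ((rcSetup d).hull γ ∪ γ.1.Opart) =
      ccount (wire (ROpen σ (freeEdges V) ω) (Vext σ V hω)) ((rcSetup d).hull γ ∪ Oblock γ) := by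
  have ht : (rcSetup d).type γ = σ := type_eq_of_mem_extContours hd hγ
  have hO : γ.1.Opart = Oblock γ := by rw [opart_eq ht, hσ, if_pos rfl]
  rw [hO]
  set U := (rcSetup d).hull γ ∪ Oblock γ
  -- `Rhull = wireAll (wire R O) (∂-blocks)` on all pairs
  have h1 : ccount (Rhull σ V ω γ) U = ccount (wireAll (wire (ROpen σ (freeEdges V) ω) (Oblock γ)) (γ.1.ordInts.image inBoundary)) U := by
    refine ccount_congr fun a _ b _ => ?_
    rw [Rhull, wireAll, wireAll, wire, hO]
    constructor
    · rintro (h | ⟨L, hL, haL, hbL⟩)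
      · exact Or.inl (Or.inl h)
      · rcases mem_insert.1 hL with rfl | hL
        · exact Or.inl (Or.inr ⟨haL, hbL⟩)
        · exact Or.inr ⟨L, hL, haL, hbL⟩
    · rintro ((h | h) | ⟨L, hL, haL, hbL⟩)
      · exact Or.inl h
      · exact Or.inr ⟨_, mem_insert_self _ _, h⟩
      · exact Or.inr ⟨L, mem_insert_of_mem hL, haL, hbL⟩
  -- the `∂`-blocks lie in one class of `wire R O` on `U`
  have h2 : ccount (wireAll (wire (ROpen σ (freeEdges V) ω) (Oblock γ)) (γ.1.ordInts.image inBoundary)) U =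
      ccount (wire (ROpen σ (freeEdges V) ω) (Oblock γ)) U := by
    refine ccount_wireAll_eq fun L hL a ha b hb => ?_
    obtain ⟨A, hA, rfl⟩ := mem_image.1 hL
    obtain ⟨hA, hlab⟩ := mem_ints_of_mem_ordInts hA
    exact reflTransGen_mono (fun _ _ _ _ h => Or.inl h) (reflTransGen_of_subset subset_union_left (inBoundary_one_class hd hω hγ hA hlab ha hb))
  -- on `U`, `wire R O = wire R Vext`
  have h3 : ccount (wire (ROpen σ (freeEdges V) ω) (Oblock γ)) U = ccount (wire (ROpen σ (freeEdges V) ω) (Vext σ V hω)) U := by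
    refine ccount_congr fun a ha b hb => or_congr_right ?_
    have key : ∀ x ∈ U, (x ∈ Oblock γ ↔ x ∈ Vext σ V hω) := fun x hx =>
      ⟨fun h => oblock_subset_Vext hd hω hγ h, fun h => (mem_union.1 hx).resolve_left fun h' =>
        Finset.disjoint_left.1 (disjoint_hull_Vext hω hγ) h' h⟩
    rw [key a ha, key b hb]
  rw [h1, h2, h3]

include hd hω hγ in
/-- For `σ = dis`: on the hull, the classes of `Rhull` are those of the open relation. [cite: Grimmett2006, §7.5] -/
theorem ccount_rhull_eq_dis (hσ : σ = Phase.dis) :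
    ccount (Rhull σ V ω γ) ((rcSetup d).hull γ ∪ γ.1.Opart) = ccount (ROpen σ (freeEdges V) ω) ((rcSetup d).hull γ) := by
  have ht : (rcSetup d).type γ = σ := type_eq_of_mem_extContours hd hγ
  have hO : γ.1.Opart = ∅ := by rw [opart_eq ht, hσ]; rfl
  rw [hO, union_empty, Rhull, hO]
  refine ccount_wireAll_eq fun L hL a ha b hb => ?_
  rcases mem_insert.1 hL with rfl | hL
  · exact absurd ha (notMem_empty a)
  · obtain ⟨A, hA, rfl⟩ := mem_image.1 hL
    obtain ⟨hA, hlab⟩ := mem_ints_of_mem_ordInts hA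
    exact inBoundary_one_class hd hω hγ hA hlab ha hb

/-! ### (G2) Peeling the hulls -/

omit hγ

include hd hω hV in
/-- **Peeling the hulls, `ord` case**: with `R_w` the `V^ext`-wired open relation,
`ccount R_w (V^ext ∪ ⋃_{𝒢} hull) + |𝒢| = 1 + Σ_{γ ∈ 𝒢} ccount R_w (hull γ ∪ O_γ)` for every subfamily `𝒢`
of the external contours (if `V ≠ ∅`). [cite: Grimmett2006, §7.5, eq. (7.22)] -/
theorem ccount_peel_ord (hVne : V.Nonempty) {𝒢 : Finset (rcSetup d).Γ} (h𝒢 : 𝒢 ⊆ extContours σ hω) :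
    ccount (wire (ROpen σ (freeEdges V) ω) (Vext σ V hω)) (Vext σ V hω ∪ 𝒢.biUnion (rcSetup d).hull) + #𝒢 =
      1 + ∑ γ ∈ 𝒢, ccount (wire (ROpen σ (freeEdges V) ω) (Vext σ V hω)) ((rcSetup d).hull γ ∪ Oblock γ) := by
  classical
  set Rw := wire (ROpen σ (freeEdges V) ω) (Vext σ V hω) with hRw
  have hRws : ∀ a b, Rw a b → Rw b a := wire_symm (rOpen_symm _ _ _) _
  induction 𝒢 using Finset.induction_on with
  | empty =>
    rw [card_empty, sum_empty, biUnion_empty, union_empty, add_zero, add_zero]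
    -- `V^ext` is non-empty (it contains the boundary layer) and wired
    have hne : (Vext σ V hω).Nonempty := by
      obtain ⟨y, hy⟩ := exBoundary_nonempty (by omega) hVne
      obtain ⟨hyV, x, hx, hxy⟩ := mem_exBoundary.1 hy
      exact ⟨x, sdiff_inner1_subset_Vext hd hω hV (mem_sdiff.2 ⟨hx, fun h => hyV (mem_inner1.1 h ((adj_iff_mem_starBall.1 hxy).1))⟩)⟩
    exact ccount_eq_one hne fun a ha b hb => ReflTransGen.single ⟨Or.inr ⟨ha, hb⟩, ha, hb⟩
  | insert γ 𝒢 hγ𝒢 ih =>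
    have hγ : γ ∈ extContours σ hω := h𝒢 (mem_insert_self _ _)
    have h𝒢' : 𝒢 ⊆ extContours σ hω := (subset_insert _ _).trans h𝒢
    set W := Vext σ V hω ∪ 𝒢.biUnion (rcSetup d).hull with hW
    have hOW : Oblock γ ⊆ W := (oblock_subset_Vext hd hω hγ).trans subset_union_left
    have hHW : Disjoint ((rcSetup d).hull γ) W := by
      rw [hW, disjoint_union_right, disjoint_biUnion_right]
      exact ⟨disjoint_hull_Vext hω hγ, fun γ' hγ' => pairwise_disjoint_hull_extContours hd hω hγ (h𝒢' hγ')
        (fun h => hγ𝒢 (h ▸ hγ'))⟩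
    have hunion : Vext σ V hω ∪ (insert γ 𝒢).biUnion (rcSetup d).hull = W ∪ ((rcSetup d).hull γ ∪ Oblock γ) := by
      rw [union_comm ((rcSetup d).hull γ) (Oblock γ), ← union_assoc W, union_eq_left.2 hOW, biUnion_insert, hW]
      ac_rfl
    have hL : W ∩ ((rcSetup d).hull γ ∪ Oblock γ) = Oblock γ := by
      rw [inter_union_distrib_left, disjoint_iff_inter_eq_empty.1 hHW.symm, empty_union, inter_eq_right.2 hOW]
    have hglue := ccount_union_add_one hRws hL (oblock_nonempty hd γ) (fun a haW haO b hb hbO => ?_)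
      (fun a ha b hb => ?_) (fun a ha b hb => ?_)
    · rw [hunion, card_insert_of_notMem hγ𝒢, sum_insert hγ𝒢]
      have := ih h𝒢'
      omega
    · have hbH : b ∈ (rcSetup d).hull γ := (mem_union.1 hb).resolve_right hbO
      have haH : a ∉ (rcSetup d).hull γ := fun h => Finset.disjoint_left.1 hHW h haW
      have hbV : b ∉ Vext σ V hω := fun h => Finset.disjoint_left.1 (disjoint_hull_Vext hω hγ) hbH h
      constructor
      · rintro (hab | ⟨-, hb'⟩)
        · exact haO (mem_oblock_of_adj hbH haH hab.1.symm)
        · exact hbV hb'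
      · rintro (hba | ⟨hb', -⟩)
        · exact haO (mem_oblock_of_adj hbH haH hba.1)
        · exact hbV hb'
    · exact ReflTransGen.single ⟨Or.inr ⟨oblock_subset_Vext hd hω hγ ha, oblock_subset_Vext hd hω hγ hb⟩, hOW ha, hOW hb⟩
    · exact ReflTransGen.single ⟨Or.inr ⟨oblock_subset_Vext hd hω hγ ha, oblock_subset_Vext hd hω hγ hb⟩,
        mem_union_right _ ha, mem_union_right _ hb⟩

include hd hω in
/-- No open edge at a site of `V^ext` when `σ = dis`. [folklore] -/
theorem not_rOpen_of_mem_Vext_dis (hσ : σ = Phase.dis) {a b : Site d} (ha : a ∈ Vext σ V hω) :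
    ¬ ROpen σ (freeEdges V) ω a b ∧ ¬ ROpen σ (freeEdges V) ω b a := by
  subst hσ
  have hg : DisGood Phase.dis (freeEdges V) ω a := good_of_mem_Vext hd hω ha
  constructor
  · rintro ⟨hab, ho⟩; exact hg _ (mk_mem_ballEdges_of_mem_nbrs (mem_nbrs.2 hab)) ho
  · rintro ⟨hba, ho⟩
    rw [Sym2.eq_swap] at ho
    exact hg _ (mk_mem_ballEdges_of_mem_nbrs (mem_nbrs.2 hba.symm)) ho

include hd hω in
/-- **Peeling the hulls, `dis` case**: `ccount R (V^ext ∪ ⋃_{𝒢} hull) = |V^ext| + Σ_{γ ∈ 𝒢} ccount R (hull γ)`.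
[cite: Grimmett2006, §7.5, eq. (7.22)] -/
theorem ccount_peel_dis (hσ : σ = Phase.dis) {𝒢 : Finset (rcSetup d).Γ} (h𝒢 : 𝒢 ⊆ extContours σ hω) :
    ccount (ROpen σ (freeEdges V) ω) (Vext σ V hω ∪ 𝒢.biUnion (rcSetup d).hull) =
      #(Vext σ V hω) + ∑ γ ∈ 𝒢, ccount (ROpen σ (freeEdges V) ω) ((rcSetup d).hull γ) := by
  classical
  induction 𝒢 using Finset.induction_on with
  | empty =>
    rw [sum_empty, biUnion_empty, union_empty, add_zero]
    exact ccount_eq_card_of_forall_not fun a ha b _ => (not_rOpen_of_mem_Vext_dis hd hω hσ ha).1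
  | insert γ 𝒢 hγ𝒢 ih =>
    have hγ : γ ∈ extContours σ hω := h𝒢 (mem_insert_self _ _)
    have h𝒢' : 𝒢 ⊆ extContours σ hω := (subset_insert _ _).trans h𝒢
    set W := Vext σ V hω ∪ 𝒢.biUnion (rcSetup d).hull with hW
    have hHW : Disjoint ((rcSetup d).hull γ) W := by
      rw [hW, disjoint_union_right, disjoint_biUnion_right]
      exact ⟨disjoint_hull_Vext hω hγ, fun γ' hγ' => pairwise_disjoint_hull_extContours hd hω hγ (h𝒢' hγ')
        (fun h => hγ𝒢 (h ▸ hγ'))⟩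
    have hunion : Vext σ V hω ∪ (insert γ 𝒢).biUnion (rcSetup d).hull = W ∪ (rcSetup d).hull γ := by
      rw [biUnion_insert, hW]; ac_rfl
    have hsep : ∀ a ∈ W, ∀ b ∈ (rcSetup d).hull γ, ¬ ROpen σ (freeEdges V) ω a b ∧ ¬ ROpen σ (freeEdges V) ω b a := by
      intro a haW b hbH
      have haH : a ∉ (rcSetup d).hull γ := fun h => Finset.disjoint_left.1 hHW h haW
      have key : ∀ {x y}, (zdGraph d).Adj x y → x ∈ (rcSetup d).hull γ → y ∉ (rcSetup d).hull γ → y ∈ Vext σ V hω :=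
        fun hxy hx hy => oblock_subset_Vext hd hω hγ (mem_oblock_of_adj hx hy hxy)
      constructor
      · intro hab; exact (not_rOpen_of_mem_Vext_dis hd hω hσ (key hab.1.symm hbH haH)).1 hab
      · intro hba; exact (not_rOpen_of_mem_Vext_dis hd hω hσ (key hba.1 hbH haH)).2 hba
    rw [hunion, ccount_union_of_separated hsep hHW.symm, ih h𝒢', sum_insert hγ𝒢]
    ring

/-! ### The cluster-count decomposition -/

include hd hω hV in
/-- **The cluster-count decomposition** (`q`-part of Grimmett (7.65)–(7.66) / FV (7.28)):
`κ^σ_V(ω) = [σ = dis]|V^ext| + Σ_{γ external} (cwt γ + Σ_{A ∈ ints γ} κ^{lab A}_A(ω ∩ freeEdges A))`.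
[cite: Grimmett2006, §7.5, eqs. (7.18)–(7.22), (7.65)–(7.66); FriedliVelenik2017, §7.3.1, eq. (7.28)] -/
theorem kappa_decomposition :
    kappa σ V (freeEdges V) ω = (if σ = Phase.dis then #(Vext σ V hω) else 0) +
      ∑ γ ∈ extContours σ hω, (γ.1.cwt + ∑ A ∈ (rcSetup d).ints γ, kappa ((rcSetup d).lab γ A) A (freeEdges A) (ω ∩ freeEdges A)) := by
  classical
  set Γ := extContours σ hω with hΓ
  have hV' := eq_Vext_union_biUnion_hull hd hω hV (σ := σ)
  -- the per-contour identity, with `cwt`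
  have hper : ∀ γ ∈ Γ, ccount (Rhull σ V ω γ) ((rcSetup d).hull γ ∪ γ.1.Opart) =
      (γ.1.cwt + if σ = Phase.ord then 1 else 0) +
        ∑ A ∈ (rcSetup d).ints γ, kappa ((rcSetup d).lab γ A) A (freeEdges A) (ω ∩ freeEdges A) := by
    intro γ hγ
    rw [ccount_hull_union_opart hd hω hV hγ, Contour.cwt, show γ.1.type = σ from type_eq_of_mem_extContours hd hγ]
    have := ccl_pos γ
    split_ifs <;> omega
  cases hσ : σ with
  | dis =>
    subst hσ
    change ccount (ROpen Phase.dis (freeEdges V) ω) V = _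
    rw [if_pos rfl, congrArg (ccount (ROpen Phase.dis (freeEdges V) ω)) hV', ccount_peel_dis hd hω rfl (Finset.Subset.refl _)]
    congr 1
    refine sum_congr rfl fun γ hγ => ?_
    rw [← ccount_rhull_eq_dis hd hω hγ rfl, hper γ hγ, if_neg (by decide), add_zero]
  | ord =>
    subst hσ
    change ccount (wire (ROpen Phase.ord (freeEdges V) ω) (V \ inner1 V)) V - 1 = _
    rw [if_neg (by decide), zero_add]
    by_cases hVne : V = ∅
    · -- empty volume
      subst hVne
      have hΓe : Γ = ∅ := by
        refine eq_empty_of_forall_notMem fun γ hγ => ?_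
        obtain ⟨x, hx⟩ := (rcSetup d).supp_nonempty γ
        exact notMem_empty x (supp_subset_of_inVol (S := rcSetup d) (inVol_of_mem_extContours hγ) hx)
      rw [hΓe, sum_empty, ccount_empty]; rfl
    -- replace the boundary-layer wiring by the `V^ext` wiring
    have hVne' : V.Nonempty := nonempty_iff_ne_empty.2 hVne
    have h1 : ccount (wire (ROpen Phase.ord (freeEdges V) ω) (V \ inner1 V)) V =
        ccount (wire (ROpen Phase.ord (freeEdges V) ω) (Vext Phase.ord V hω)) V := by
      rw [← ccount_wireAll_eq (ℬ := {Vext Phase.ord V hω}) (fun L hL a ha b hb => ?_)]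
      · refine ccount_congr fun a _ b _ => ?_
        rw [wireAll, wire, wire]
        constructor
        · rintro ((h | ⟨ha, hb⟩) | ⟨L, hL, haL, hbL⟩)
          · exact Or.inl h
          · exact Or.inr ⟨sdiff_inner1_subset_Vext hd hω hV ha, sdiff_inner1_subset_Vext hd hω hV hb⟩
          · rw [mem_singleton] at hL; subst hL; exact Or.inr ⟨haL, hbL⟩
        · rintro (h | ⟨ha, hb⟩)
          · exact Or.inl (Or.inl h)
          · exact Or.inr ⟨_, mem_singleton_self _, ha, hb⟩
      · rw [mem_singleton] at hL; subst hL
        exact vext_one_class_ord hd hω rfl ha hb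
    have h2 := ccount_peel_ord hd hω hV hVne' (Finset.Subset.refl Γ)
    rw [← hV'] at h2
    rw [h1]
    -- each summand is `≥ 1`; rewrite with `hper`
    have h3 : ∑ γ ∈ Γ, ccount (wire (ROpen Phase.ord (freeEdges V) ω) (Vext Phase.ord V hω)) ((rcSetup d).hull γ ∪ Oblock γ) =
        ∑ γ ∈ Γ, (γ.1.cwt + ∑ A ∈ (rcSetup d).ints γ, kappa ((rcSetup d).lab γ A) A (freeEdges A) (ω ∩ freeEdges A)) + #Γ := by
      rw [← mul_one #Γ, ← smul_eq_mul, ← sum_const, ← sum_add_distrib]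
      refine sum_congr rfl fun γ hγ => ?_
      rw [← ccount_rhull_eq_ord hd hω hγ rfl, hper γ hγ, if_pos rfl]; ring
    rw [h3] at h2
    omega

end Setting

end RCC

end Literature.Probability.LatticeModels

end
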